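import Summits.Ventures.WeilGRH.KeySectionClosure
import Summits.Ventures.WeilGRH.KeyMinorantParity
import HarnessLib

/-!
# Assembly: pseudo-key sections PSD ⇒ a rung for EVERY Dirichlet character above the floor; the all-moduli
  statement at `t = 1` modulo the finite remainder

Cell `rh-explicit`, WEIL TRACK — GRH ARM (weil-grh-5; `GRH-LIT-AS-PRINTED.md` A37/A42).  The lead's label of
record for «Weil positivity on `[−1, 1]` for EVERY Dirichlet character» (R10-2) is «THEOREM for `q ≥ 256` / odd
`q ≥ 80`; CERTIFIED + LEMMA TYPED, composition MODULO TYPING, below».  This file writes the composition as ONE Lean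
implication with its two remaining inputs as explicit hypotheses, so that «modulo typing» has an exact shape:

* `weilPositivityOnChar_of_pseudoKey_sections_nonneg` — ANY window `t > 0` with `e^{2t} ≤ N + 1`, any level `L₀`:
  if every trigonometric section `Σ_{|n|≤M} c_n χ_n` of Yoshida's `K(t)` has non-negative key form at the EVEN
  all-trivial pseudo-key `(0, L₀, 1)`, then `WeilPositivityOnChar χ t` for EVERY Dirichlet character `χ` mod
  `q ≠ 1` (either parity, any values, imprimitive allowed) with `L₀ ≤ log q` — the section door
  (`keyMarkovForm_nonneg_of_forall_section_nonneg`, KeySectionClosure) into the minorant/parity door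
  (`weilPositivityOnChar_of_allTrivial_even_key_nonneg`, KeyMinorantParity);
* `weilPositivityOnChar_one_of_pseudoKey75_sections_and_small` — at `t = 1`, `L₀ = log 75` (weil-grh-2's exact
  even pseudo-key floor, trivial-key-minorant-CERT cd94b3eb3ac50002): [sections PSD at `(0, log 75, 1)`, window 1]
  ∧ [the rung at `t = 1` for every character of every modulus `2 ≤ q < 75`] ⇒ the rung at `t = 1` for every
  Dirichlet character of every modulus `q ≥ 2`.

The first hypothesis is what a K(1)-closure certificate asserts once its tail step (rh-explicit-moll-step0-1's
(Z2)–(Z6)) is typed; the second is the A2 table's certified `t = 1` column below 75 (per character; imprimitive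
characters by the convexity of the key polytope, `weilPositivityOnChar_of_key_convexComb`).  Nothing here is an
instance: no certificate is evaluated.  Everything is proved; no definitions, no named facts, RH/GRH-free.
[cite: Weil1952FormulesExplicites, (11) pp. 261–262; Yoshida1992, §0 p. 282 and §3 p. 289]
-/

set_option autoImplicit false

noncomputable section

open Complex Filter Set MeasureTheory
open scoped Real Topology ComplexConjugate ArithmeticFunction.vonMangoldt

namespace Summit.Ventures.WeilGRH

open Literature.NumberTheory.LFunctions
open Literature.NumberTheory.LFunctions.Yoshida1992 (modes chi)
open Summit.RiemannHypothesis.RiemannHypothesis.Theorems.WeilFormatC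

variable {q : ℕ}

/-- **Pseudo-key sections PSD ⇒ the rung for every character above the level.**  `t > 0`, `e^{2t} ≤ N + 1`; if
`0 ≤ keyMarkovForm 0 L₀ 1 t (Σ_{|n|≤M} c_n χ_n)` for all `M`, `c` (all trigonometric sections of `K(t)` at the EVEN
all-trivial pseudo-key of level `L₀`), then `WeilPositivityOnChar χ t` for every `χ` mod `q ≠ 1` with `L₀ ≤ log q`
(both parities). [cite: Yoshida1992, §0 p. 282; Weil1952FormulesExplicites, (11) pp. 261–262] -/
theorem weilPositivityOnChar_of_pseudoKey_sections_nonneg {L₀ t : ℝ} (ht : 0 < t) {N : ℕ}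
    (hN : Real.exp (2 * t) ≤ (N : ℝ) + 1)
    (hsec : ∀ (M : ℕ) (c : ℤ → ℂ), 0 ≤ keyMarkovForm 0 L₀ (fun _ ↦ 1) t (∑ n ∈ modes M, c n • chi t n))
    (hq : q ≠ 1) (χ : DirichletCharacter ℂ q) (hL : L₀ ≤ Real.log q) :
    WeilPositivityOnChar χ t := by
  refine weilPositivityOnChar_of_allTrivial_even_key_nonneg ht hN (fun g hg hsupp ↦ ?_) hq χ hL
  rw [← keyMarkovForm_eq_weilFinitePrimeQuadraticKey hg hsupp hN (Nat.zero_le 1) L₀ (fun _ ↦ 1)]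
  exact keyMarkovForm_nonneg_of_forall_section_nonneg ht hsec (Yoshida1992.C_le_K ht ⟨hg, hsupp⟩)

/-- The same at the standard windows `t = log(N+1)/2` in `WeilPositivityOnKey` language: all sections PSD at the
even pseudo-key `(0, L₀, 1)` of `K(t_N)` ⇒ every `χ` mod `q ≠ 1` with `L₀ ≤ log q` has the rung `t` for every
`0 < t ≤ log(N+1)/2`. [cite: Yoshida1992, §0 p. 282] -/
theorem weilPositivityOnChar_of_pseudoKey_sections_nonneg_le {L₀ : ℝ} {N : ℕ} (hN : 1 ≤ N)
    (hsec : ∀ (M : ℕ) (c : ℤ → ℂ), 0 ≤ keyMarkovForm 0 L₀ (fun _ ↦ 1) (Real.log ((N : ℝ) + 1) / 2)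
      (∑ n ∈ modes M, c n • chi (Real.log ((N : ℝ) + 1) / 2) n))
    (hq : q ≠ 1) (χ : DirichletCharacter ℂ q) (hL : L₀ ≤ Real.log q) {t : ℝ} (ht : 0 < t)
    (htN : t ≤ Real.log ((N : ℝ) + 1) / 2) :
    WeilPositivityOnChar χ t :=
  weilPositivityOnChar_of_weilPositivityOnKey_allTrivial_even
    (weilPositivityOnKey_of_forall_section_nonneg (Nat.zero_le 1) L₀ (fun _ ↦ 1) hN hsec) ht htN hq χ hL

/-- `e² ≤ 8`: the window `t = 1` sees the prime powers `n ≤ 7`. -/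
private theorem exp_two_le_eight : Real.exp (2 * (1 : ℝ)) ≤ ((7 : ℕ) : ℝ) + 1 := by
  have h := Real.exp_one_lt_d9
  have h0 := Real.exp_pos (1 : ℝ)
  rw [mul_one, show (2 : ℝ) = (1 : ℝ) + 1 by norm_num, Real.exp_add]
  push_cast
  nlinarith

/-- **«t = 1 for EVERY Dirichlet character», assembled.**  If (i) every trigonometric section of `K(1)` has
non-negative key form at the even all-trivial pseudo-key of level `log 75` (weil-grh-2's exact even floor at
`t = 1`), and (ii) every Dirichlet character of every modulus `2 ≤ q < 75` satisfies `WeilPositivityOnChar χ 1`,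
then EVERY Dirichlet character of EVERY modulus `q ≥ 2` satisfies `WeilPositivityOnChar χ 1`.
(i) is the content of a K(1)-closure certificate once its tail step is typed; (ii) is the certified A2 column.
[cite: Weil1952FormulesExplicites, (11) pp. 261–262] -/
theorem weilPositivityOnChar_one_of_pseudoKey75_sections_and_small
    (hsec : ∀ (M : ℕ) (c : ℤ → ℂ), 0 ≤ keyMarkovForm 0 (Real.log 75) (fun _ ↦ 1) 1 (∑ n ∈ modes M, c n • chi 1 n))
    (hsmall : ∀ q : ℕ, 2 ≤ q → q < 75 → ∀ χ : DirichletCharacter ℂ q, WeilPositivityOnChar χ 1)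
    (hq : 2 ≤ q) (χ : DirichletCharacter ℂ q) :
    WeilPositivityOnChar χ 1 := by
  by_cases h75 : q < 75
  · exact hsmall q hq h75 χ
  · push Not at h75
    have hq1 : q ≠ 1 := by omega
    have hL : Real.log 75 ≤ Real.log q :=
      Real.log_le_log (by norm_num) (by exact_mod_cast h75)
    exact weilPositivityOnChar_of_pseudoKey_sections_nonneg one_pos exp_two_le_eight hsec hq1 χ hL

/-- Parametric form of the assembly (any floor `q₀ ≥ 2`, window `t = 1`): [sections PSD at `(0, log q₀, 1)`,
window 1] ∧ [rung at 1 for every character of every modulus `2 ≤ q < q₀`] ⇒ rung at 1 for every character of every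
modulus `q ≥ 2`. [cite: Weil1952FormulesExplicites, (11) pp. 261–262] -/
theorem weilPositivityOnChar_one_of_pseudoKey_sections_and_small {q₀ : ℕ} (hq₀ : 2 ≤ q₀)
    (hsec : ∀ (M : ℕ) (c : ℤ → ℂ),
      0 ≤ keyMarkovForm 0 (Real.log q₀) (fun _ ↦ 1) 1 (∑ n ∈ modes M, c n • chi 1 n))
    (hsmall : ∀ q : ℕ, 2 ≤ q → q < q₀ → ∀ χ : DirichletCharacter ℂ q, WeilPositivityOnChar χ 1)
    (hq : 2 ≤ q) (χ : DirichletCharacter ℂ q) :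
    WeilPositivityOnChar χ 1 := by
  by_cases hlt : q < q₀
  · exact hsmall q hq hlt χ
  · push Not at hlt
    have hq1 : q ≠ 1 := by omega
    have hq₀pos : (0 : ℝ) < q₀ := by exact_mod_cast (by omega : 0 < q₀)
    have hL : Real.log q₀ ≤ Real.log q := Real.log_le_log hq₀pos (by exact_mod_cast hlt)
    exact weilPositivityOnChar_of_pseudoKey_sections_nonneg one_pos exp_two_le_eight hsec hq1 χ hL

end Summit.Ventures.WeilGRH

end
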